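import Mathlib
import Summits.QuantumFields.YangMills.Theses.SmallFieldWidening
import Summits.QuantumFields.YangMills.Theorems.SmallFieldWideningLargeFieldMassRefinementTailOfStepOnlyFrom

/-! BC3 skeleton v10.2 (lead ym-line-sfw-p2 gen 88; v10 REGISTERED 2026-08-30T06:27:18Z; v10.1 = + PRICE paragraph; v10.2 = + w2 g48's price file §4 merged — declarations byte-identical throughout) for crux r3 `LargeFieldMassRefinementTail` of route SmallFieldWidening
(stmt-QuantumFields-22884), line `birth` — ADOPTED byte-for-byte (docstring + namespace only) from width seat ym-line-sfw-p2-w2 gen 47's candidate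
`Lines/birth_v10_candidate.lean` (sha256 285ab547…, evidence 2026-08-30T06:24:11Z), after the lead's checks: `lean check` rc 0 · sorries 1; the closer
`LargeFieldMassRefinementTailStepOnlyFrom.largeFieldMassRefinementTail_of_stepOnlyFrom` (✓p763760) has axioms [propext, Classical.choice, Quot.sound] (unconditional);
its (base) input `HistoryTailBoundedHeightLocal.perPlaquette_boundedHeight_uniform` (cell ym3-torus) is a tree theorem; the k₀ = 1 base independently ✓p763635
(`LargeFieldMassRefinementTailBaseTail.baseClause_firstRun`, over ✓p763218 LocalWordStokes + ✓p763480 LocalAveragedPlaquette).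

REGISTRY HISTORY.  v1 (2026-08-27: PerRunMass + SeriesTail) … v7 (`stub_unitTopSummable`) → v8 (planner's local split) → v9 (lead g33, 2026-08-28T13:20Z, sha 174570fc,
re-registered unchanged by leads g34–g88: ONE stub `stub_localStepFloor` = (base) ∧ (slack) ∧ (card) ∧ (step), base rate `c_b` before the precision `η`, starting
run `k₀` after it; = child crux 27718 `PlainStabAdd`'s registered stub verbatim) → v10 (THIS FILE): the (base) conjunct is PROVED in the tree for every FIXED
starting run, so the registered stub shrinks to `stub_stepOnlyFrom` = (slack) ∧ (card) ∧ (step) from a `k₀` fixed with `L, b₀, p₀` (before `η`); the letters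
`c_b, C_b, N_b` are gone.  The only supplier freedom lost w.r.t. v9 is a precision-dependent starting run `k₀(η)`; a supplier who needs it proves v9's
`stub_localStepFloor` instead, which STAYS registered on the child crux 27718 (interface of record, planner ruling n3 of 2026-08-28T12:13Z) and closes this crux
by the landed v9 closer `PlainStabAddOfLocalStepFloor.largeFieldMassRefinementTail_of_localStepFloor`; conversely an inhabitant of `stub_stepOnlyFrom` closes 27718 by
`LargeFieldMassRefinementTailStepOnlyFrom.plainStabAdd_of_stepOnlyFrom` (✓p763760).  So the pair 22884/27718 now registers BOTH doors, one each; nothing is filed twice.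

THE ONE REGISTERED STUB `stub_stepOnlyFrom` (XL — the open content is UNCHANGED: the cutoff-uniform, EVENT-level, one-sided one-step small-field RG comparison of
the unit-plaquette tail restricted to the supplier's local finest-small-field guard; [Balaban1985UV3] (70)–(71) p.273, [Balaban1987RG1] Thm 1 p.259,
[Balaban1989LargeFieldII] §1 print DENSITY comparisons, not event probabilities — class open-in-print; `Lines/birth_dead.md` §§1–33 apply verbatim to it,
incl. §33: the stub is ℰ-sensitive, no ℰ-generic technique can prove it).  Held by the lead; wave: none — 1 stub left.
COMPOSITION: `LargeFieldMassRefinementTail_holds_of_stubs := largeFieldMassRefinementTail_of_stepOnlyFrom stub_stepOnlyFrom` — the crux BY NAME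
(`StepOnlyFrom` → `LocalStepFloor` → `PlainStabAdd` → r3, every glue landed: p763760, p633597, p631613).
PRICE P OF THE RESHAPE (critic idea-crit-4 g12 RESHAPE PRE-VIEW 2026-08-30T06:25:28Z + PRICE REWORDED 06:27:19Z, planner ym-idea-2 g19 06:27:04Z; answered by
the lead g88 in v10.1 — declarations byte-identical to v10, docstring only; width seat w2 g48's `Lines/birth_v10_price.md` is merged here when filed).
THE QUANTIFIER SWAP.  v10 fixes the starting run `k₀` BEFORE the precision `η` (v9: after).  Dichotomy (critic/planner, adopted): the swap is HARMLESS iff at each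
FIXED run j the slack the supplier needs is o(p(√γ)²) as γ → 0; it is a GENUINE STRENGTHENING iff that slack has a γ-uniform floor ρ_j(γ) ≥ c_j·p(√γ)².
WHAT PRINT SAYS (quoted; corpus keys paper:balaban1987-cmp109-rg-i-small-field, paper:balaban1985-cmp102-uv-stability-3d).  [Balaban1987RG1] p.258 (0.27): «the first
exponential can be bounded by an arbitrary positive power of L^jη»; p.258 after (0.29): «These inequalities yield a uniform bound of the sum (0.23) on the lattice T_η,
i.e. the only dependence on k is through the volume |T_η|»; p.259: «The proof also covers the dimension d = 3, but in that case it is not necessary to consider the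
β-functions … The effective coupling constants are given by g_k = g²L^kε; hence the assumption of the above theorem is satisfied for g sufficiently small»; p.260,
after (1.3): «We have written explicitly terms of the order 0 in the coupling constants»; [Balaban1985UV3] p.273 (70): «… + O(1)(g_j p(g_j))³», (71): «for g_j
sufficiently small».  READING (the γ-dependence AT FIXED RUN): the irrelevant terms E^{(j)}(X, U_k) of the small-field effective action sit INSIDE the 1/g_k² bracket of
(1.3) — order ZERO in the coupling — and are geometric in the scale, O((L^jη)^{d+α})·e^{−κ d_j(X)}; so the unit-lattice effective actions of runs K and K+1 (one extra
finest scale) differ at order zero by O(γ⁻¹·L^{−αK}) per unit volume: γ-UNIFORM relative to the main term and geometric in K; the corrections beyond order zero carry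
positive powers of g_j p(g_j) ((70)), at the unit height powers of √γ·p(√γ).
CONSEQUENCE FOR THE SLACK.  On the unit-plaquette tail at threshold √γ·p the order-zero difference acts, up to relative O(√γ·p) (semiclassical counting: field ≍ √γ·z,
γ⁻¹(γz² + γ^{3/2}z³ + …)), through the QUADRATIC form only, i.e. as a γ-uniform, K-geometric shift of the tree-level variance σ_K² of dist1(Ū^K(∂q))/√γ — Maxwell rung,
kit j291705 (bc/gauss_kuniform.md, L = 3, F = dA, (0.4)-averaging): σ_K² = R[K][K] = 0.2541, 0.2153, 0.2110, 0.2105 for K = 1, 2, 3, 4 (drift ratio ≈ L⁻²).  WITHOUT the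
threshold schedule this is the second branch verbatim: ρ_K^{tree} = (p²/2)·|σ_{K+1}⁻² − σ_K⁻²| = c_K·p² with c₁ ≈ 0.36, c₂ ≈ 0.047, c₃ ≈ 0.006, γ-uniform — `∀η ∃k₀`
satisfiable (k₀(η) ≍ log_{L²}(0.4/η)), `∃k₀ ∀η` NOT.  WITH the schedule t_K ∈ [½,1] — in the letter since `PlainStabAdd` rev 2 (2026-08-28T11:53Z) for exactly this
purpose — t_K := σ_K/σ_{k₀} aligns the tree-level exponents EXACTLY, t_K²p²/(2σ_K²) ≡ p²/(2σ_{k₀}²) (the unit plaquette's su(2) marginal is isotropic at tree level: ONE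
variance parameter, so one multiplier per run suffices; prefactors align too), admissible iff sup_{K≥k₀} σ_K ≤ 2·inf_{K≥k₀} σ_K — Maxwell rung from k₀ = 1:
σ₁/σ_∞ = (0.2541/0.2105)^{1/2} = 1.10, t_K ∈ [0.91, 1] ✓ (w2 g43's check «sup σ² < 4 inf σ²», same numbers).  The residual slack is the order-(√γ·p) part of the drift,
ρ_K ≍ C·√γ·p(√γ)³·L^{−αK}: o(p(√γ)²) at fixed K because √γ·p(√γ) → 0 — the HARMLESS branch: k₀ = 1, γ₁(η) with C·√γ₁·p(√γ₁)/(1 − L^{−α}) ≤ η, the γ-free O(1)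
prefactor differences in A.  VERDICT ON P: the swap is harmless GIVEN the t-window and GIVEN that the tree-level variance profile of the (0.4)-averaged unit plaquette stays
within a factor 4 along the whole cutoff ladder (Maxwell rung: yes, margin 1.21 vs 4; for the interacting law this alignment is part of what the (step) supplier proves, as it
was under v9); then v10 WITH k₀ = 1 is the honest letter and w2 g47's ✓p763635 `baseClause_firstRun` is exactly its base.  A supplier whose method cannot align thresholds
(t ≡ 1) faces the γ-uniform order-zero drift, needs a precision-dependent start, and proves v9's `stub_localStepFloor` instead — registered on 27718, landed closer for 22884
(p633597) — so the pair of registries loses nothing either way.  Q2 («keep ∀η∃k₀ and supply a k₀-UNIFORM base rate; M-sized?»): NO — `perPlaquette_boundedHeight_uniform L j₀`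
with a rate independent of j₀ is the cutoff-uniform unit-height tail itself (j₀ ranges over all runs), i.e. the open content (v7's `UnitTopSummable` door, p622460); the decay
c(L,j₀) ≍ c·λ_L^{2j₀} of the tree's constant is the artefact of iterated deterministic propagation (birth_dead §3: a factor L^{3/2} lost per step) and removing it IS the RG step.
Hence v9's order «∃c_b ∀η ∃k₀(η)» lets a supplier who sends k₀(η) → ∞ owe the open content TWICE (base and step); v10 owes it once.  (Caricature-level and print-order-counting
reasoning, not a theorem; recorded so the registry choice is argued, per the critic's gate «PASS-WITH-PRICE iff P is in the skeleton docstring».)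
WIDTH SEAT w2 g48's PRICE FILE (merged by reference + its §4 verbatim; critic idea-crit-4 g12 verdict of record 2026-08-30T06:41:49Z: «PRICE P … MET from print; v10
verdict of record becomes PASS (no open price)»): `Cruxes/LargeFieldMassRefinementTail/Lines/birth_v10_price.md` v3 (tree sha256 a575d3f722899ba0…, 13346 B, evidence #59 on
22884) — §1 quotes the field-dependent one-step corrections WITH the running coupling ([Balaban1985UV3] (44)–(46) p.267), §2 is the t-window computation above in w2's letters,
§3 = Q2, §4b a heuristic EVENT-level size ρ_K ≍ γp⁴L^{−κK} (the tail event is even in the curvature ⇒ no first-order response ⇒ volume-uniform).  Its §4, verbatim: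
«PRICE P (idea-crit-4 g12, 2026-08-30T06:27Z) — why ∃k₀ ∀η is the honest order here (d = 3): the precision η is NOT bought by the starting run but by the coupling window
γ₁(η): every field-dependent one-step small-field correction in print carries the running coupling of the step, [Balaban1985UV3] (44)–(46) p.267 «Σ_j Σ_{Y_j}|𝓔_j(Y_j,U_k)| ≤
O(1)M₁⁶g²_{k−1}p²(g_{k−1})|Λ_k| … not only convergent, but also small», p.257 «the constant O(1) is independent of ε, k, g_k in a bounded set», [Balaban1987RG1] Thm 1 p.259 (d = 3:
«g_k² = g²L^kε; hence the assumption … is satisfied for g sufficiently small»); with g² = γL^{−K} at the extra finest step of run K+1 these are o(p(√γ)²) at every FIXED run.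
The one γ-uniform geometric effect, the free-covariance lattice drift v_K = v_∞ + O(L^{−2K}) of the averaged unit plaquette, is a threshold rescaling carried by t_K ∈ [1/2,1]
(t_K := (v_K/sup v)^{1/2}, zero ρ-cost); field-independent vacuum energies ((64)–(65) p.273) cancel in probabilities.  k₀ only places the start inside the t-window (free
covariances, L-dependent), hence before η.  In d = 4 ((0.29): coupling-free irrelevant terms) this order WOULD be a strengthening.  Print is density-level; (step) is
event-level and open (birth_dead §§1–4, §33).»  (Reconciliation with the lead's paragraph above: the ORDER-ZERO irrelevant terms of (1.3)/(0.29) are exactly §2's free-covariance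
drift — γ-uniform, paid by t; the FIELD-DEPENDENT interaction terms (44)–(46) carry g²p²(g) — paid by γ₁(η); both readings give the harmless branch with k₀ = 1.)
No summit is proved by this line (rung R3 RECORD label; the YM mass gap is NOT proved by any of this). -/

noncomputable section

namespace Summit.QuantumFields.YangMills.Cruxes.LargeFieldMassRefinementTail.Birth

open MeasureTheory Filter Topology
open scoped BigOperators
open Literature.MathematicalPhysics.QuantumFieldTheory
open Literature.MathematicalPhysics.QuantumFieldTheory.Balaban1983to89
open Literature.MathematicalPhysics.QuantumFieldTheory.Balaban1983to89.Missing
open Literature.MathematicalPhysics.QuantumFieldTheory.Balaban1983to89.T3ContinuumYM3Torus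
open Literature.MathematicalPhysics.QuantumFieldTheory.Balaban1983to89.T3UnitScaleTilt
open Literature.MathematicalPhysics.QuantumFieldTheory.Balaban1983to89.T3UnitLawDensityEML (ℰp)
open Literature.MathematicalPhysics.QuantumFieldTheory.Balaban1983to89.T3LevelShift
open Summit.QuantumFields.YangMills.Theorems
open Summit.QuantumFields.YangMills.Theorems.LargeFieldMassRefinementTailStepOnlyFrom (largeFieldMassRefinementTail_of_stepOnlyFrom)

/-- THE ONE STUB `stub_stepOnlyFrom` (XL): a starting run `k₀ ≥ 1` and a guard profile `b' > 0` fixed with `L, b₀, p₀`; then for every precision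
`η > 0` a locality exponent `M`, a coupling window `γ₁ ∈ (0,1]` and `A` with: for every family `F` (`F.L = L`, ANY volume), every `0 < γ ≤ γ₁` and
every unit plaquette label `q`, one-step slacks `ρ_K`, threshold multipliers `t_K ∈ [1/2,1]` and finest-plaquette sets `S_K` of run `K+1` such that
(slack) every interval sum `Σ_{k≤j<K} ρ_j ≤ A + η·p(√γ)²` (`k ≥ k₀`), (card) `|S_K| ≤ (L^{K+1})^M` (`K ≥ k₀`), and (step)
`Gibbs_{K+1}({t_{K+1}θ(0) ≤ |Ū^{K+1}(∂q) − 1|} ∩ {every p ∈ S_K is θ_{b'}(K+1)-small}) ≤ e^{ρ_K}·Gibbs_K{t_Kθ(0) ≤ |Ū^K(∂q) − 1|}` (`K ≥ k₀`).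
Verbatim the hypothesis of `LargeFieldMassRefinementTailStepOnlyFrom.largeFieldMassRefinementTail_of_stepOnlyFrom`.
[cite: Balaban1985UV3, (70)-(71) p.273; Balaban1987RG1, Thm 1 p.259; Balaban1989LargeFieldII, §1 pp.355-356] -/
theorem stub_stepOnlyFrom :
    ∀ (L : ℕ) (b₀ p₀ : ℝ), 0 < b₀ → 2 < p₀ → ∃ (k₀ : ℕ) (b' : ℝ), 1 ≤ k₀ ∧ 0 < b' ∧ ∀ η : ℝ, 0 < η →
      ∃ (M : ℕ) (γ₁ A : ℝ), 0 < γ₁ ∧ γ₁ ≤ 1 ∧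
      ∀ (F : T3Family) (γ : ℝ), F.L = L → 0 < γ → γ ≤ γ₁ →
        ∀ q : Plaq (F.P 0) 0, ∃ (ρ t : ℕ → ℝ) (S : (K : ℕ) → Finset (Plaq (F.P (K + 1)) 0)),
          (∀ K : ℕ, 1 / 2 ≤ t K ∧ t K ≤ 1) ∧
          (∀ k K : ℕ, k₀ ≤ k → ∑ j ∈ Finset.Ico k K, ρ j ≤ A + η * B10.pFun b₀ p₀ (Real.sqrt γ) ^ 2) ∧
          (∀ K : ℕ, k₀ ≤ K → ((S K).card : ℝ) ≤ ((F.L : ℝ) ^ (K + 1)) ^ M) ∧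
          ∀ K : ℕ, k₀ ≤ K →
            (gibbsK F ℰp γ (K + 1)).real ({U | t (K + 1) * θBal F.L γ b₀ p₀ 0 ≤ GaugeGroup.dist1 (GaugeField.plaqHol
                (Averaging.iter (fun i => BlockAveraging.blockAvg (P := F.P (K + 1)) (j := i) ℰp) (K + 1) U)
                (plaqShift (F.sitesPerDir_unit (K + 1)) q))} ∩
              {U | PlaqSmallOn (↑(S K) : Set (Plaq (F.P (K + 1)) 0)) (θBal F.L γ b' p₀ (K + 1)) U}) ≤
            Real.exp (ρ K) *
            (gibbsK F ℰp γ K).real {U | t K * θBal F.L γ b₀ p₀ 0 ≤ GaugeGroup.dist1 (GaugeField.plaqHol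
                (Averaging.iter (fun i => BlockAveraging.blockAvg (P := F.P K) (j := i) ℰp) K U)
                (plaqShift (F.sitesPerDir_unit K) q))} := by
  sorry

/-- The crux modulo the ONE stub: r3 `LargeFieldMassRefinementTail` BY NAME (`StepOnlyFrom` → `LocalStepFloor` → `PlainStabAdd` → r3, all glues landed). -/
theorem LargeFieldMassRefinementTail_holds_of_stubs :
    Summit.QuantumFields.YangMills.Theses.SmallFieldWidening.LargeFieldMassRefinementTail :=
  largeFieldMassRefinementTail_of_stepOnlyFrom stub_stepOnlyFrom

end Summit.QuantumFields.YangMills.Cruxes.LargeFieldMassRefinementTail.Birth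

end
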